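import Summits.QuantumFields.YangMills.Theses.RenyiTelescope

/-!
# Crux `HistoryTailL` (stmt-QuantumFields-19936) — LINE «renyi-telescope», REPAIRED 2026-08-28 (ideator seat ym-r3-idea-2 g3, lens «nearmiss»)

SUPERSEDES the registration of `Lines/renyi_telescope.lean` at commit a87d9a3e0f7a in one point: the conditional-Rényi crux is now the
REPAIRED `CutoffRenyiLR` (stmt-QuantumFields-27544; exponent `R₀(q−1)p⁴L^(3F.m)(γ²/L^(2J) + 1/L^(4J))`, orders `1 < q ≤ Q·L^J`) instead of
`CutoffRenyiL` (27137, now `aside`: as typed — exponent `L^(−4J)`, orders up to `Q·L^(2J)` — it is predicted FALSE by the one-loop O(g²a)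
renormalisation of the d = 3 lattice gauge coupling, Moore 1998, Nucl. Phys. B523:569, arXiv:hep-lat/9709053 p.8 eq. (gaugerenorm) / p.16:
consecutive cut-offs of the T3 tower differ at FIRST order in the spacing, `δ_J ≈ 0.63·γ·L^(−J)`, so `D_q ≈ (q/4)·N·δ_J² ∝ q·γ²·L^(3F.m)·L^(−2J)`).
The telescope still closes because refinement trades cut-off for coupling (`γ_d² = γ²L^(−2d)` against the volume `L^(3(F.m+d))`); the re-glue
`HistoryTailOfRenyiTelescopeR` (stmt-QuantumFields-27545) carries a registered skeleton (3 stubs K-R / A-R / R-R re-deriving the telescoped bound,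
the arithmetic closure and the instantiation for orders `q_J = κ(3/2)^J`, `J₀(d) = d − ⌊d/8⌋`; the five crux-independent glue pieces — conditional
telescope p622611, plaquette transport p623159, unit-event reduction p623509, abstract bootstrap p623811, interior complement p623983 — are landed).

REGISTERED STUBS (the ONLY sorries): `stub_cutoffRenyiR` (= crux 27544), `stub_fineRegimeUnitTail` (= crux 27138),
`stub_historyTailOfRenyiTelescopeR` (= re-glue support 27545).  Composition `historyTailL_of_stubs` = modus ponens (kernel-checked).
WHAT THIS IS NOT: no stub is proved here; `HistoryTailL`, the rung `YM3TorusSU2` and the summit are NOT proved by this file.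
-/

namespace Summit.QuantumFields.YangMills.Cruxes.HistoryTailL.RenyiTelescopeR

/-- STUB (XL, crux stmt-QuantumFields-27544): the repaired conditional cut-off Rényi comparison. -/
theorem stub_cutoffRenyiR : Summit.QuantumFields.YangMills.Theses.RenyiTelescope.CutoffRenyiLR := by
  sorry

/-- STUB (L, crux stmt-QuantumFields-27138): the fine-regime semiclassical unit-plaquette tail. -/
theorem stub_fineRegimeUnitTail : Summit.QuantumFields.YangMills.Theses.RenyiTelescope.FineRegimeUnitTailL := by
  sorry

/-- STUB (M, support stmt-QuantumFields-27545; skeleton registered: stub_telescopedCruxR / stub_arithClosureR / stub_glueRestR): the re-glue. -/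
theorem stub_historyTailOfRenyiTelescopeR : Summit.QuantumFields.YangMills.Theses.RenyiTelescope.HistoryTailOfRenyiTelescopeR := by
  sorry

/-! ## §2 The crux BY NAME — no sorry below this line -/

theorem historyTailL_of_stubs
    (hC : Summit.QuantumFields.YangMills.Theses.RenyiTelescope.CutoffRenyiLR)
    (hF : Summit.QuantumFields.YangMills.Theses.RenyiTelescope.FineRegimeUnitTailL)
    (hG : Summit.QuantumFields.YangMills.Theses.RenyiTelescope.HistoryTailOfRenyiTelescopeR) :
    Summit.QuantumFields.YangMills.Theses.UnitScaleTilt.HistoryTailL :=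
  hG hC hF

/-- The crux item BY NAME, modulo exactly the three registered stubs. -/
theorem HistoryTailL_of : Summit.QuantumFields.YangMills.Theses.UnitScaleTilt.HistoryTailL :=
  historyTailL_of_stubs stub_cutoffRenyiR stub_fineRegimeUnitTail stub_historyTailOfRenyiTelescopeR

end Summit.QuantumFields.YangMills.Cruxes.HistoryTailL.RenyiTelescopeR
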